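import Summits.Parity.GeneralizedHardyLittlewood.Theses.LZZCertificateReplay

/-!
# Route `LZZCertificateReplay` — the assembly item

The assembly item of route `LZZCertificateReplay` (Parity / GeneralizedHardyLittlewood, D-0059 rung
F-P2, narrow leaf): `ReplayedCertificates → Theorem21 → NoExceptionalZeroUpTo 400000 (1/5)`.
`ReplayedCertificates` is by definition the implication
`LuZamanZhao2026.theorem21 → NoExceptionalZeroUpTo 400000 (1/5)` and `Theorem21` is
`LuZamanZhao2026.theorem21`, so the assembly is modus ponens. Nothing analytic is proved here; the
two cruxes stay open.
-/

namespace Summit.Parity.GeneralizedHardyLittlewood.Theorems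

open Summit.Parity.GeneralizedHardyLittlewood.Theses

/-- **Assembly of route `LZZCertificateReplay`** (item `Assembly`): the kernel replay of the
Lu–Zaman–Zhao certificates (`ReplayedCertificates`, an implication from the printed Theorem 2.1)
and the printed Theorem 2.1 itself (`Theorem21`) together give `NoExceptionalZeroUpTo 400000 (1/5)`:
no primitive quadratic Dirichlet `L`-function of modulus `3 ≤ q ≤ 4·10⁵` vanishes on
`[1 − 1/(5 log q), 1] ∩ (0, 1]`. Proof: modus ponens. -/
theorem lzzCertificateReplay_assembly_proof : LZZCertificateReplay.Assembly := by
  unfold LZZCertificateReplay.Assembly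
  intro h1 h2
  exact h1 h2

end Summit.Parity.GeneralizedHardyLittlewood.Theorems
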